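import Summits.Langlands.Langlands.Theorems.RamifiedCoefficientSeedAdjointLiftingGL3BirthDefs3
import Literature.NumberTheory.GaloisRepresentations.PstWeilDeligneFontaineLaffaille
import HarnessLib

/-!
# Route `RamifiedCoefficientSeed`, crux `AdjointLiftingGL3` (stmt-Langlands-16779): vocabulary of the
# line `birth`, part 4 (the LOCAL form of stub S2a)

Fourth vocabulary file of the line (after `…BirthDefs.lean` p161710, `…BirthDefs2.lean` p164420,
`…BirthDefs3.lean` p165693).  Stub S2a (`stub_localShape : … → LocalShapeAt p ρ₀ η`) factors through a
purely LOCAL statement about a non-archimedean local field `K` (intended: `K = ℚ_v`, `v ∣ p`), a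
two-dimensional `V : Γ_K → GL₂(ℤ̄_p/𝔪)` (intended: `ρ̄₀|_{Γ_K}`), a character `χ : Γ_K → GL₁(ℤ̄_p/𝔪)`
(intended: `η̄|_{Γ_K}`) and a three-dimensional `T = χ ⊗ ad⁰ V` (intended: `ρ̄|_{Γ_K}`), whose
hypothesis is the conclusion of the accepted clause (F13)
`PstWeilDeligneData.FontaineLaffailleReductions` (file
`Literature/NumberTheory/GaloisRepresentations/PstWeilDeligneFontaineLaffaille.lean`, integrated into
`IsFontaineDatum` by p166439) for `T` and the weight multiset `{0, 1, 2}`.  Two predicates: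

* `FLDataAt K p T ι ϖ hϖ H` — conjuncts (i) (tame inertia weights) and (ii) (rank-two subquotients:
  ordering and peu ramifié) of (F13), VERBATIM, for `n = 3`, the reduction `T` and an abstract weight
  multiset `H` in place of `𝔇.𝔅.labelledHodgeTateWeights ρ τ` (so that the pinned datum's clause,
  applied to `ρ|_{Γ_{ℚ_v}}` crystalline of labelled weights `{0,1,2}` and its reduction `T`, IS
  `FLDataAt (ℚ_v) p T ι ϖ hϖ {0,1,2}` after rewriting the weights).
* `LocalShapeOf K p V χ ι ϖ hϖ := InertialCharEq K p χ ι ϖ hϖ ∧ LocalShapeT K p V ι ϖ hϖ` — clauses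
  (E) and (T) of the accepted `LocalShapeAt` (BirthDefs3) for the local pair `(V, χ)` in place of
  `(τ₀ ∘ j, η̄ ∘ j)`, `j = absGaloisRestrict ℚ ℚ_v`; the bridge `localShapeAt_iff` is definitional.
* `WildFrameOf K p V ι ϖ hϖ` — the intermediate datum of the wild case (Serre §2.4): `V` not tame,
  upper triangular on all of `Γ_K`, inertial diagonal `(ω^{s+e}, ω^s)`, `e = ±1`.  The local core of
  S2a is proved in two registered halves: from `FLDataAt` (conjunct (i)) to
  `InertialCharEq ∧ (LocalShapeT ∨ WildFrameOf)`, and from `WildFrameOf` and conjunct (ii) to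
  `LocalShapeT`.

NOTHING IS ASSERTED; declared in the skeleton's namespace; no import of the route module.
-/

set_option linter.dupNamespace false -- `Summit.Langlands.Langlands` is the mandated namespace

noncomputable section

namespace Summit.Langlands.Langlands.Cruxes.AdjointLiftingGL3.Birth

open scoped MatrixGroups NumberField Valued
open NumberField IsDedekindDomain Field Filter ValuativeRel
open Literature.NumberTheory.GaloisRepresentations Literature.NumberTheory.PAdicHodge
open Literature.NumberTheory.GaloisRepresentations.IsNonarchimedeanLocalField

section Local

variable (K : Type) [Field K] [ValuativeRel K] [TopologicalSpace K] [IsNonarchimedeanLocalField K]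

/-- **Fontaine–Laffaille data for a rank-three reduction `T` with weight multiset `H`**: the two
conjuncts of the accepted clause (F13) `PstWeilDeligneData.FontaineLaffailleReductions`, verbatim for
`n = 3` and the reduction `ρb := T`, with the abstract multiset `H` in place of the labelled
Hodge–Tate weights: (i) blocks `B` with digit multiset `H`, a change of basis `P` and diagonal
characters `d` enumerating the block characters with `P T(σ) P⁻¹` upper triangular of diagonal
`d(σ)` on `I_K`; (ii) for every change of basis, middle index `i`, and `a, b ∈ H`: a `Γ_K`-block
upper triangular `P T P⁻¹` for `{< i} ∪ {i, i+1} ∪ {> i+1}` whose middle block is upper triangular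
with inertial diagonal `(ω^{-b}, ω^{-a})` and non-split has `b < a`, and is trivial on every
`I_K^v`, `v > 1`, when `a = b + 1`.
[cite: FontaineLaffaille1982, Prop. 4.4 and Thm. 5.3 (iii) (p. 570)]
[cite: GeeHerzigLiuSavitt2017, Prop. 2.3.1, Def. 2.1.2 and Examples 2.1.4 (1)] -/
def FLDataAt (p : ℕ) [Fact p.Prime]
    (T : absoluteGaloisGroup K →* GL (Fin 3) (padicAlgClResidueField p))
    (ι : absIntegers 𝒪[K] K ⧸ absMaximalIdeal K →+* padicAlgClResidueField p) (ϖ : 𝒪[K])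
    (hϖ : Irreducible ϖ) (H : Multiset ℤ) : Prop :=
  -- (i) tame inertia weights = `H`
  (∃ (B : List (Σ h : ℕ, Fin h → ℤ)) (P : GL (Fin 3) (padicAlgClResidueField p))
      (d : Fin 3 → (↥(absInertia K) →* (padicAlgClResidueField p)ˣ)),
      flBlockDigits B = H ∧
      (Finset.univ : Finset (Fin 3)).val.map d = flBlockCharacters K ι ϖ hϖ B ∧
      ∀ σ : ↥(absInertia K), ∀ i j : Fin 3,
        (j < i → ((P * T (σ : absoluteGaloisGroup K) * P⁻¹ : GL (Fin 3) _) :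
          Matrix (Fin 3) (Fin 3) (padicAlgClResidueField p)) i j = 0) ∧
        (((P * T (σ : absoluteGaloisGroup K) * P⁻¹ : GL (Fin 3) _) :
          Matrix (Fin 3) (Fin 3) (padicAlgClResidueField p)) i i = ((d i σ : _ˣ) : _))) ∧
  -- (ii) rank-two subquotients: ordering and peu ramifié
  (∀ (P : GL (Fin 3) (padicAlgClResidueField p)) (i : ℕ) (hi : i + 1 < 3) (a b : ℤ),
      a ∈ H → b ∈ H →
      (∀ (σ : absoluteGaloisGroup K) (r c : Fin 3),
          ((i ≤ r.val ∧ c.val < i) ∨ (i + 2 ≤ r.val ∧ c.val < i + 2) ∨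
              (r.val = i + 1 ∧ c.val = i)) →
            ((P * T σ * P⁻¹ : GL (Fin 3) _) :
              Matrix (Fin 3) (Fin 3) (padicAlgClResidueField p)) r c = 0) →
      (∀ σ : ↥(absInertia K),
          ((P * T (σ : absoluteGaloisGroup K) * P⁻¹ : GL (Fin 3) _) :
              Matrix (Fin 3) (Fin 3) (padicAlgClResidueField p)) ⟨i, by omega⟩ ⟨i, by omega⟩ =
            (((fundamentalCharacter K 1 ι ϖ hϖ) ^ (-b)) σ : _ˣ) ∧
          ((P * T (σ : absoluteGaloisGroup K) * P⁻¹ : GL (Fin 3) _) :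
              Matrix (Fin 3) (Fin 3) (padicAlgClResidueField p)) ⟨i + 1, hi⟩ ⟨i + 1, hi⟩ =
            (((fundamentalCharacter K 1 ι ϖ hϖ) ^ (-a)) σ : _ˣ)) →
      (¬ ∃ Q : GL (Fin 2) (padicAlgClResidueField p), ∀ (σ : absoluteGaloisGroup K) (r c : Fin 2),
          r ≠ c →
            ((Q : Matrix (Fin 2) (Fin 2) (padicAlgClResidueField p)) *
                middleBlock (((P * T σ * P⁻¹ : GL (Fin 3) _) :
                  Matrix (Fin 3) (Fin 3) (padicAlgClResidueField p))) i hi *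
                ((Q⁻¹ : GL (Fin 2) (padicAlgClResidueField p)) :
                  Matrix (Fin 2) (Fin 2) (padicAlgClResidueField p))) r c = 0) →
      b < a ∧
        (a = b + 1 → ∀ v : ℝ, 1 < v → ∀ σ ∈ absUpperInertia K v,
          middleBlock (((P * T σ * P⁻¹ : GL (Fin 3) _) :
            Matrix (Fin 3) (Fin 3) (padicAlgClResidueField p))) i hi = 1))

/-- **(E) for a local character**: `χ = ω⁻¹` on the inertia group `I_K` (`ω = ψ₁` the level-one
fundamental character w.r.t. `ι`, `ϖ`). [cite: Serre1987, §2.1] -/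
def InertialCharEq (p : ℕ) [Fact p.Prime]
    (χ : absoluteGaloisGroup K →* GL (Fin 1) (padicAlgClResidueField p))
    (ι : absIntegers 𝒪[K] K ⧸ absMaximalIdeal K →+* padicAlgClResidueField p) (ϖ : 𝒪[K])
    (hϖ : Irreducible ϖ) : Prop :=
  ∀ σ : ↥(absInertia K),
    ((χ (σ : absoluteGaloisGroup K) : GL (Fin 1) (padicAlgClResidueField p)) :
        Matrix (Fin 1) (Fin 1) _) 0 0 =
      (((fundamentalCharacter K 1 ι ϖ hϖ σ)⁻¹ : (padicAlgClResidueField p)ˣ) :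
        padicAlgClResidueField p)

/-- **(T) for a local two-dimensional `V`**: for some `s`, either the level-one shape
`P V(σ) P⁻¹ = ω(σ)^s • (ω(σ) c_σ; 0 1)` on `I_K` together with `V = 1` on every `I_K^u`, `u > 1`
(peu ramifié or split), or the level-two shape `P V(σ) P⁻¹ = ω(σ)^s • diag(ω₂(σ), ω₂(σ)^p)` on `I_K`
(`ω = ψ₁`, `ω₂ = ψ₂`). [cite: Serre1987, §2.2 and §2.4] [cite: GeeHerzigLiuSavitt2017, Prop. 2.3.1] -/
def LocalShapeT (p : ℕ) [Fact p.Prime]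
    (V : absoluteGaloisGroup K →* GL (Fin 2) (padicAlgClResidueField p))
    (ι : absIntegers 𝒪[K] K ⧸ absMaximalIdeal K →+* padicAlgClResidueField p) (ϖ : 𝒪[K])
    (hϖ : Irreducible ϖ) : Prop :=
  ∃ s : ℕ,
    (∃ P : GL (Fin 2) (padicAlgClResidueField p),
        (∀ σ : ↥(absInertia K), ∃ c : padicAlgClResidueField p,
          ((P * V (σ : absoluteGaloisGroup K) * P⁻¹ : GL (Fin 2) (padicAlgClResidueField p)) :
              Matrix (Fin 2) (Fin 2) _) =
            (((fundamentalCharacter K 1 ι ϖ hϖ σ) ^ s : (padicAlgClResidueField p)ˣ) :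
                padicAlgClResidueField p) •
              !![(((fundamentalCharacter K 1 ι ϖ hϖ σ) : (padicAlgClResidueField p)ˣ) :
                  padicAlgClResidueField p), c;
                0, 1]) ∧
        ∀ u : ℝ, 1 < u → ∀ σ ∈ absUpperInertia K u, V σ = 1) ∨
    (∃ P : GL (Fin 2) (padicAlgClResidueField p),
        ∀ σ : ↥(absInertia K),
          ((P * V (σ : absoluteGaloisGroup K) * P⁻¹ : GL (Fin 2) (padicAlgClResidueField p)) :
              Matrix (Fin 2) (Fin 2) _) =
            (((fundamentalCharacter K 1 ι ϖ hϖ σ) ^ s : (padicAlgClResidueField p)ˣ) :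
                padicAlgClResidueField p) •
              !![(((fundamentalCharacter K 2 ι ϖ hϖ σ) : (padicAlgClResidueField p)ˣ) :
                  padicAlgClResidueField p), 0;
                0, (((fundamentalCharacter K 2 ι ϖ hϖ σ) ^ p : (padicAlgClResidueField p)ˣ) :
                  padicAlgClResidueField p)])

/-- **The local shape of a pair `(V, χ)` over `K`**: clauses (E) (`InertialCharEq`) and (T)
(`LocalShapeT`) of `LocalShapeAt`, for a local two-dimensional `V : Γ_K → GL₂(ℤ̄_p/𝔪)` and a
character `χ : Γ_K → GL₁(ℤ̄_p/𝔪)`. [cite: Serre1987, §2.2 and §2.4]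
[cite: GeeHerzigLiuSavitt2017, Prop. 2.3.1] -/
def LocalShapeOf (p : ℕ) [Fact p.Prime]
    (V : absoluteGaloisGroup K →* GL (Fin 2) (padicAlgClResidueField p))
    (χ : absoluteGaloisGroup K →* GL (Fin 1) (padicAlgClResidueField p))
    (ι : absIntegers 𝒪[K] K ⧸ absMaximalIdeal K →+* padicAlgClResidueField p) (ϖ : 𝒪[K])
    (hϖ : Irreducible ϖ) : Prop :=
  InertialCharEq K p χ ι ϖ hϖ ∧ LocalShapeT K p V ι ϖ hϖ

/-- **A wild frame for `V`** (the intermediate datum of the wild case, Serre §2.4 (2.4.1)–(2.4.3)):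
`V` is NOT tamely ramified (some `I_K^u`, `u > 0`, acts non-trivially) and is upper triangular on
ALL of `Γ_K` in the basis `P`, with inertial diagonal `(ω^s · ω^e, ω^s)` for an exponent
`e ∈ {1, -1}` (the two orderings the Fontaine–Laffaille weights `{0,1,2}` of `χ ⊗ ad⁰ V` allow; clause
(ii) of (F13) then excludes `e = -1` and forces peu ramifié). [cite: Serre1987, §2.4 (2.4.1)–(2.4.3)] -/
def WildFrameOf (p : ℕ) [Fact p.Prime]
    (V : absoluteGaloisGroup K →* GL (Fin 2) (padicAlgClResidueField p))
    (ι : absIntegers 𝒪[K] K ⧸ absMaximalIdeal K →+* padicAlgClResidueField p) (ϖ : 𝒪[K])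
    (hϖ : Irreducible ϖ) : Prop :=
  (∃ u : ℝ, 0 < u ∧ ∃ σ ∈ absUpperInertia K u, V σ ≠ 1) ∧
    ∃ (P : GL (Fin 2) (padicAlgClResidueField p)) (s : ℕ) (e : ℤ), (e = 1 ∨ e = -1) ∧
      (∀ g : absoluteGaloisGroup K,
        ((P * V g * P⁻¹ : GL (Fin 2) (padicAlgClResidueField p)) :
          Matrix (Fin 2) (Fin 2) (padicAlgClResidueField p)) 1 0 = 0) ∧
      ∀ σ : ↥(absInertia K),
        ((P * V (σ : absoluteGaloisGroup K) * P⁻¹ : GL (Fin 2) (padicAlgClResidueField p)) :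
            Matrix (Fin 2) (Fin 2) _) 1 1 =
          (((fundamentalCharacter K 1 ι ϖ hϖ σ) ^ s : (padicAlgClResidueField p)ˣ) :
            padicAlgClResidueField p) ∧
        ((P * V (σ : absoluteGaloisGroup K) * P⁻¹ : GL (Fin 2) (padicAlgClResidueField p)) :
            Matrix (Fin 2) (Fin 2) _) 0 0 =
          (((fundamentalCharacter K 1 ι ϖ hϖ σ) ^ s : (padicAlgClResidueField p)ˣ) :
            padicAlgClResidueField p) *
          ((((fundamentalCharacter K 1 ι ϖ hϖ) ^ e) σ : (padicAlgClResidueField p)ˣ) :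
            padicAlgClResidueField p)

end Local

/-- **`LocalShapeAt` is `LocalShapeOf` at the completions** `ℚ_v`, `v ∣ p`, of the pull-backs
`τ₀ ∘ j`, `η̄ ∘ j` along `j = absGaloisRestrict ℚ ℚ_v` (definitional bridge). [folklore] -/
theorem localShapeAt_iff :
    ∀ (p : ℕ) [Fact p.Prime] (ρ₀ : FramedGaloisRep ℚ (PadicAlgCl p) 2)
      (η : FramedGaloisRep ℚ (PadicAlgCl p) 1),
    LocalShapeAt p ρ₀ η ↔
      ∀ (v : HeightOneSpectrum (𝓞 ℚ)) (_hv : ((p : ℕ) : 𝓞 ℚ) ∈ v.asIdeal)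
        (τ₀ : absoluteGaloisGroup ℚ →* GL (Fin 2) (padicAlgClResidueField p))
        (ηb : absoluteGaloisGroup ℚ →* GL (Fin 1) (padicAlgClResidueField p)),
        ρ₀.IsResidualRepOf (RingHom.id _) τ₀ → η.IsReductionOf (RingHom.id _) ηb →
        ∀ (ιr : absIntegers (↥(ValuativeRel.valuation (v.adicCompletion ℚ)).integer)
              (v.adicCompletion ℚ) ⧸ absMaximalIdeal (v.adicCompletion ℚ) →+* padicAlgClResidueField p)
          (ϖ : ↥(ValuativeRel.valuation (v.adicCompletion ℚ)).integer) (hϖ : Irreducible ϖ),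
          LocalShapeOf (v.adicCompletion ℚ) p
            (τ₀.comp (absGaloisRestrict ℚ (v.adicCompletion ℚ)).toMonoidHom)
            (ηb.comp (absGaloisRestrict ℚ (v.adicCompletion ℚ)).toMonoidHom) ιr ϖ hϖ :=
  fun _ _ _ _ => Iff.rfl

end Summit.Langlands.Langlands.Cruxes.AdjointLiftingGL3.Birth

end
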